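import Summits.HubbardSuperconductivity.HubbardSuperconductivity.Theorems.AnisotropyChordTransferFibre3RowDLoopMajE
import Summits.HubbardSuperconductivity.HubbardSuperconductivity.Theorems.AnisotropyChordTransferFibre3RowDTLoopBdry
import Summits.HubbardSuperconductivity.HubbardSuperconductivity.Theorems.AnisotropyChordTransferFibre3ManifoldA64

/-!
# Route `AnisotropyChord` / H0 rotor rung, row D (KT-2a) on the t-BLOCKS: block twin of `…AnisotropyChordTransferFibre3RowDLoopMajE`

T-FORK (p2 g8; inventory memo HOME/hubbard-h0-rotor-p2/TBLOCK-INVENTORY-g8.md §3): the theorems of `…RowDLoopMajE` that carry the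
hypothesis `128 ≤ L` (or the `L2.NamedCell` cell box) restated in the namespace `RowD.T` with the SAME names for the t-blocks of
the range `48 ≤ L < 128` (route-lead ruling R1): analytic layer with `64 ≤ L` (family A at `L ≥ 64`: `ManifoldA.nu_ceiling64`,
`manifold_band64`), cell layer on block cells `c : L2.TCell` (`cellBoxB (c.box a₁ a₂)`, `pmem_xTrueT`,
`RowC.finalVec_mem_of_cellFinalBoxT`).  Definitions that do not depend on the cell are NOT duplicated (they resolve to `RowD`);
proofs are verbatim.  Kept: eval_S1h_D, atom_facts, eval_bnd3E, eval_bndME, eval_bpgE, eval_bspE.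
Prover seat `hubbard-h0-rotor-p2` g8; helper for piece A = stmt-HubbardSuperconductivity-23918 of rung 19089 (`--supports`, helper
class).  Nothing here proves superconductivity in the Hubbard model; lemmas for ONE row of ONE conditional reduction on the t-blocks;
the rotor TARGET as originally worded stays FALSE (g15 verdict).  Tree imports only; no sorry.
-/

set_option linter.dupNamespace false
set_option autoImplicit false

open Literature.Analysis.ValidatedNumerics

namespace Summit.HubbardSuperconductivity.HubbardSuperconductivity.Theorems.AnisotropyChord.Transfer.Fibre3

namespace RowD

namespace T

open RowC L2.N1

variable (L : ℕ) [NeZero L]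

/-! ## Atoms -/

section atoms
variable (Δ lam2 : ℝ) (f : Tor L → ℝ)

/-- ★ `S1h ↦ Ŝ₁ = θ²S₁` at the row-D vector (ground profile, `L ≥ 128`; gap equation `c_sS₁ = V − a(V−1) = V·u`). [folklore] -/
theorem eval_S1h_D (hL : 64 ≤ L) (hΔ0 : 0 ≤ Δ) (hΔ1 : Δ < 1) (hf : IsGroundTwoMagnon L Δ lam2 f) :
    S1h.eval (xTrueD L Δ lam2 f) = (2 * Real.pi / L) ^ 2 * S1n L lam2 := by
  have hlam : 0 < lam2 := lam2_pos L (by omega) hΔ1 hf.1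
  obtain ⟨_, dcs, duu⟩ := dictD L Δ lam2 f (by omega) hΔ0 hΔ1 hf hlam
  have hgap := gapEquationS1_holds L (by omega) hΔ0 hΔ1 lam2 f hf hlam
  unfold aPar at hgap
  obtain ⟨ha0, haV, -, -⟩ := ManifoldA.manifold_band64 L hL hΔ0 hΔ1 hf
  have hLpos : (0 : ℝ) < L := by exact_mod_cast (show 0 < L by omega)
  have hV : (0 : ℝ) < (L : ℝ) ^ 2 := by positivity
  have hu : 0 < 1 - Δ * f (K1 L) + Δ * f (K1 L) / (L : ℝ) ^ 2 := by
    have : Δ * f (K1 L) * (1 - 1 / (L : ℝ) ^ 2) = Δ * f (K1 L) - Δ * f (K1 L) / (L : ℝ) ^ 2 := by ring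
    linarith
  have hcs : cS L Δ lam2 f ≠ 0 := by
    intro h0
    rw [h0, zero_mul] at hgap
    have : (L : ℝ) ^ 2 - Δ * f (K1 L) * ((L : ℝ) ^ 2 - 1) = (L : ℝ) ^ 2 * (1 - Δ * f (K1 L) + Δ * f (K1 L) / (L : ℝ) ^ 2) := by
      field_simp; ring
    rw [this] at hgap
    have := mul_pos hV hu
    linarith
  simp only [S1h, RExpr.eval, cst, vPi2, xTrueD_one, dcs, duu]
  push_cast
  have hS : S1n L lam2 = ((L : ℝ) ^ 2 - Δ * f (K1 L) * ((L : ℝ) ^ 2 - 1)) / cS L Δ lam2 f := by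
    rw [eq_div_iff hcs, mul_comm]; exact hgap
  rw [hS]
  field_simp
  ring

end atoms

/-! ## The tables in hat units -/

section evals
variable (Δ lam2 : ℝ) (f : Tor L → ℝ)

/-- the common atom facts, with `V = L²` eliminated: `L² = 4π²/t`. [folklore] -/
theorem atom_facts (hL : 64 ≤ L) (hΔ0 : 0 ≤ Δ) (hΔ1 : Δ < 1) (hf : IsGroundTwoMagnon L Δ lam2 f) :
    (xTrueD L Δ lam2 f 0 = (2 * Real.pi / L) ^ 2) ∧ (xTrueD L Δ lam2 f 1 = Real.pi ^ 2) ∧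
    (xTrueD L Δ lam2 f 3 = Δ * f (K1 L)) ∧ (xTrueD L Δ lam2 f 4 = ((2 * Real.pi / L) ^ 2) ^ 2 * S2n L lam2) ∧
    cs.eval (xTrueD L Δ lam2 f) = cS L Δ lam2 f ∧ S1h.eval (xTrueD L Δ lam2 f) = (2 * Real.pi / L) ^ 2 * S1n L lam2 ∧
    cZE.eval (xTrueD L Δ lam2 f) = cZ (lam2 / (2 * Real.pi / L) ^ 2) ∧
    gmaxE.eval (xTrueD L Δ lam2 f) = (2 * Real.pi / L) ^ 2 * (1 / (2 * eps1 L - lam2)) ∧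
    K3E.eval (xTrueD L Δ lam2 f) = 1 / (4 * Real.pi ^ 2) ^ 3 ∧ ((L : ℝ) ^ 2 = 4 * Real.pi ^ 2 / (2 * Real.pi / L) ^ 2) := by
  have hlam : 0 < lam2 := lam2_pos L (by omega) hΔ1 hf.1
  obtain ⟨_, dcs, _⟩ := dictD L Δ lam2 f (by omega) hΔ0 hΔ1 hf hlam
  have hLpos : (0 : ℝ) < L := by exact_mod_cast (show 0 < L by omega)
  refine ⟨xTrueD_zero L Δ lam2 f, xTrueD_one L Δ lam2 f, xTrueD_three L Δ lam2 f, xTrueD_four L Δ lam2 f, dcs,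
    eval_S1h_D L Δ lam2 f hL hΔ0 hΔ1 hf, eval_cZE L Δ lam2 f, eval_gmaxE L Δ lam2 f, eval_K3E L Δ lam2 f, ?_⟩
  field_simp
  ring

/-- ★ `bnd3E ↦ bnd3At/(V³t)`. [folklore] -/
theorem eval_bnd3E (hL : 64 ≤ L) (hΔ0 : 0 ≤ Δ) (hΔ1 : Δ < 1) (hf : IsGroundTwoMagnon L Δ lam2 f) (ku kw kw' : Bool) :
    (bnd3E ku kw kw').eval (xTrueD L Δ lam2 f) = bnd3At L Δ lam2 f ku kw kw' / (((L : ℝ) ^ 2) ^ 3 * (2 * Real.pi / L) ^ 2) := by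
  obtain ⟨h0, h1, h3, h4, hcs, hS1, hcz, -, hK3, hV⟩ := atom_facts L Δ lam2 f hL hΔ0 hΔ1 hf
  have hLpos : (0 : ℝ) < L := by exact_mod_cast (show 0 < L by omega)
  have ht : 0 < (2 * Real.pi / L : ℝ) ^ 2 := by positivity
  have hπ : Real.pi ≠ 0 := Real.pi_ne_zero
  unfold bnd3At bnd3
  rw [hV]
  cases ku <;> cases kw <;> cases kw' <;>
    simp only [bnd3E, RExpr.eval, cst, vA, vS2, vT, vPi2, h0, h1, h3, h4, hcs, hS1, hcz, hK3]
  · push_cast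
    generalize cZ (lam2 / (2 * Real.pi / L) ^ 2) = cz
    field_simp
  · push_cast
    rw [sqrt_hat2 ht]
    generalize cZ (lam2 / (2 * Real.pi / L) ^ 2) = cz
    generalize Real.sqrt (cz * S1n L lam2 * (4 * Real.pi ^ 2 / (2 * Real.pi / ↑L) ^ 2)) = sq
    field_simp
  · push_cast
    rw [sqrt_hat2 ht]
    generalize cZ (lam2 / (2 * Real.pi / L) ^ 2) = cz
    generalize Real.sqrt (cz * S1n L lam2 * (4 * Real.pi ^ 2 / (2 * Real.pi / ↑L) ^ 2)) = sq
    field_simp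
  · generalize cZ (lam2 / (2 * Real.pi / L) ^ 2) = cz
    field_simp
  · push_cast
    generalize cZ (lam2 / (2 * Real.pi / L) ^ 2) = cz
    field_simp
  · push_cast
    rw [sqrt_hat1]
    generalize cZ (lam2 / (2 * Real.pi / L) ^ 2) = cz
    generalize Real.sqrt (cz * S2n L lam2 * S1n L lam2) = sq
    field_simp
  · push_cast
    rw [sqrt_hat1]
    generalize cZ (lam2 / (2 * Real.pi / L) ^ 2) = cz
    generalize Real.sqrt (cz * S2n L lam2 * S1n L lam2) = sq
    field_simp
  · generalize cZ (lam2 / (2 * Real.pi / L) ^ 2) = cz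
    field_simp

/-- ★ `bndME ↦ bndMAt/V³`. [folklore] -/
theorem eval_bndME (hL : 64 ≤ L) (hΔ0 : 0 ≤ Δ) (hΔ1 : Δ < 1) (hf : IsGroundTwoMagnon L Δ lam2 f) (k3 k1 k2 : Bool) :
    (bndME k3 k1 k2).eval (xTrueD L Δ lam2 f) = bndMAt L Δ lam2 f k3 k1 k2 / ((L : ℝ) ^ 2) ^ 3 := by
  obtain ⟨h0, h1, h3, h4, hcs, hS1, -, hgm, hK3, hV⟩ := atom_facts L Δ lam2 f hL hΔ0 hΔ1 hf
  have hLpos : (0 : ℝ) < L := by exact_mod_cast (show 0 < L by omega)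
  have ht : 0 < (2 * Real.pi / L : ℝ) ^ 2 := by positivity
  have hπ : Real.pi ≠ 0 := Real.pi_ne_zero
  have hε : 2 * eps1 L - lam2 ≠ 0 := by
    have := lam2_lt_two_eps1 L (by omega) hΔ0 hf; linarith
  unfold bndMAt bndM
  rw [hV]
  cases k3 <;> cases k1 <;> cases k2 <;>
    simp only [bndME, RExpr.eval, cst, vA, vS2, vT, vPi2, h0, h1, h3, h4, hcs, hS1, hgm, hK3]
  · push_cast
    field_simp
  · field_simp
  · field_simp
  · field_simp
  · field_simp
  · field_simp
  · field_simp
  · field_simp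

/-- ★ `bpgE ↦ bpgAt/(V³t)`. [folklore] -/
theorem eval_bpgE (hL : 64 ≤ L) (hΔ0 : 0 ≤ Δ) (hΔ1 : Δ < 1) (hf : IsGroundTwoMagnon L Δ lam2 f) (k k' : Bool) :
    (bpgE k k').eval (xTrueD L Δ lam2 f) = bpgAt L Δ lam2 f k k' / (((L : ℝ) ^ 2) ^ 3 * (2 * Real.pi / L) ^ 2) := by
  obtain ⟨h0, h1, h3, h4, hcs, hS1, hcz, -, hK3, hV⟩ := atom_facts L Δ lam2 f hL hΔ0 hΔ1 hf
  have hLpos : (0 : ℝ) < L := by exact_mod_cast (show 0 < L by omega)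
  have ht : 0 < (2 * Real.pi / L : ℝ) ^ 2 := by positivity
  have hπ : Real.pi ≠ 0 := Real.pi_ne_zero
  unfold bpgAt bpg
  rw [hV]
  cases k <;> cases k' <;>
    simp only [bpgE, RExpr.eval, cst, vA, vS2, vT, vPi2, h0, h1, h3, h4, hcs, hS1, hcz, hK3]
  · push_cast
    generalize cZ (lam2 / (2 * Real.pi / L) ^ 2) = cz
    field_simp
  · push_cast
    rw [sqrt_hat2 ht]
    generalize cZ (lam2 / (2 * Real.pi / L) ^ 2) = cz
    generalize Real.sqrt (cz * S1n L lam2 * (4 * Real.pi ^ 2 / (2 * Real.pi / ↑L) ^ 2)) = sq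
    field_simp
  · push_cast
    generalize cZ (lam2 / (2 * Real.pi / L) ^ 2) = cz
    field_simp
  · rw [sqrt_hat1]
    generalize cZ (lam2 / (2 * Real.pi / L) ^ 2) = cz
    generalize Real.sqrt (cz * S2n L lam2 * S1n L lam2) = sq
    field_simp

/-- ★ `bspE ↦ bspAt/(V³t)`. [folklore] -/
theorem eval_bspE (hL : 64 ≤ L) (hΔ0 : 0 ≤ Δ) (hΔ1 : Δ < 1) (hf : IsGroundTwoMagnon L Δ lam2 f) (k k' : Bool) :
    (bspE k k').eval (xTrueD L Δ lam2 f) = bspAt L Δ lam2 f k k' / (((L : ℝ) ^ 2) ^ 3 * (2 * Real.pi / L) ^ 2) := by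
  obtain ⟨h0, h1, h3, h4, hcs, hS1, -, -, hK3, hV⟩ := atom_facts L Δ lam2 f hL hΔ0 hΔ1 hf
  have hLpos : (0 : ℝ) < L := by exact_mod_cast (show 0 < L by omega)
  have ht : 0 < (2 * Real.pi / L : ℝ) ^ 2 := by positivity
  have hπ : Real.pi ≠ 0 := Real.pi_ne_zero
  unfold bspAt bsp
  rw [hV]
  cases k <;> cases k' <;>
    simp only [bspE, RExpr.eval, cst, vA, vS2, vT, vPi2, h0, h1, h3, h4, hcs, hS1, hK3]
  · push_cast
    field_simp
  · field_simp
  · field_simp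
  · field_simp

end evals

end T

end RowD

end Summit.HubbardSuperconductivity.HubbardSuperconductivity.Theorems.AnisotropyChord.Transfer.Fibre3
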